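import Summits.HodgeConjecture.HodgeCM.Model.LevelTranslate
import Summits.HodgeConjecture.HodgeCM.Model.LevelTransferPush
import Literature.AlgebraicGeometry.ShimuraVarieties.UnitaryBallQuotientKaehlerClassTower
import Literature.AlgebraicGeometry.HodgeTheory.FiniteCoverRationalDescent
import HarnessLib

/-!
# The tower Kähler class system of the Picard modular surfaces of one hermitian space, from the weight law

Fan A, binder `h413` ([Liu 2021, Prop. 4.13]), junction «Matsushima at the pin», row III-4′(b): the Model-side GLUING that
replaces the named fact `BallQuotientKaehlerClassSystem` (row B3-25; an intrinsic class `ω_X = c₁(K_X)` on EVERY compact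
unitary ball quotient of EVERY dimension) by what the `ω`-normalised Hodge–Riemann level forms of
`A3Liu413LevelSummand` / `A3Liu413LevelForm` actually consume — a family of rational Kähler classes on the levels
`X_Δ`, `Δ : Level V`, of ONE hermitian space `V` (anisotropic regime), EXACTLY compatible with the rational translates
`t_γ : X_{Δ₁} ⟶ X_{Δ₂}` (`γ ∈ U(V)(L₀)`, `γ Δ₁ γ⁻¹ ≤ Δ₂`) and the level coverings — granted only the weight law
`BallFS.fsFormClass_weight_comm` (row B3-25′, `k'·[[G]^*ω_FS] = k·[[G']^*ω_FS]` on one free ball quotient;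
Griffiths–Harris Ch. 1 §2).

CONSTRUCTION (`exists_towerKaehlerClassSystem`). Every level carries the chosen ball datum `D_Δ` (same complex Gram
matrix `V.Hm^{ι₁}` for all `Δ`, `ballDatum_Hℂ_eq`), one Sylvester frame transported to all levels, an immersive
projective system `G_Δ` of Poincaré series of some weight `k_Δ > 0` (`BallProjective.exists_immersive_system`) and the
class `c_Δ ∈ H²(X_Δ(ℂ); ℂ)` comparing to `[[G_Δ]^*ω_FS]`; the REAL class `κ_Δ := k_Δ⁻¹ · c_Δ` is then EXACTLY functorial,
`f^* κ_{Δ₂} = κ_{Δ₁}` for every morphism over a translation (`smul_map_eq_smul_of_pullback_eq_fsForm`: `f^* c_{Δ₂}`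
compares to the twisted system `S_ĝ G_{Δ₂}` of weight `k_{Δ₂}`, and the weight law normalises it). ONE global scale
`r := r₀ k_{Δ₀}` is read off a reference level `Δ₀` (`exists_kaehlerRationalDatum_fsForm`: `K.η ⊗ 1 = r₀ · c_{Δ₀}`); for an
arbitrary `Δ` the common level `M := Δ ⊓ Δ₀` gives `lc_{M→Δ}^*(r κ_Δ) = r κ_M = lc_{M→Δ₀}^*(K.η ⊗ 1)`, a RATIONAL class,
whence `r κ_Δ` is rational by the normalised transfer of the finite covering `lc_{M→Δ}`
(`IsRationalClass.of_map_isFiniteCover`, `isFiniteCover_levelCover`); `ω_Δ` is the rational class with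
`ω_Δ ⊗ 1 = r κ_Δ`. (K) `r κ_Δ = (r/k_Δ) · c_Δ` is a Kähler class (`isKaehlerClass_smul_of_pullback_eq_fsForm`); (Ω2)/(Ω1)
are the real functoriality read back through the injection `H²(–; ℚ) ↪ H²(–; ℂ)`.

KERNEL ONLY (theorems; no definition, no named fact). HC_CM is proved only modulo the 7 printed citations until rung 0
closes; this file discharges nothing by itself — it turns the residual of `h413` (b) from row B3-25 into row B3-25′
(`BallFS.fsFormClass_weight_comm`, explicit hypothesis `hFS`).
-/

noncomputable section

open scoped Matrix
open Matrix Function Set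
open NumberField CategoryTheory
open Literature.AlgebraicGeometry.Motives
open Literature.AlgebraicGeometry.ShimuraVarieties
open Literature.AlgebraicGeometry.HodgeTheory
open Literature.AlgebraicTopology.SingularHomology
open Literature.NumberTheory.Automorphic
open Literature.NumberTheory.Automorphic.PicardCM
open Literature.NumberTheory.Transcendental (Arapura2012_Cor_15_4_6 integrationDeRhamIsoFamily)
open Literature.Geometry.ComplexHyperbolic.BallModel (U21 Ball)
open HodgeCM.Model.LevelCoveringTwist (ConjInto conjInto_one_of_le)

namespace HodgeCM

namespace Model.LevelTranslate

variable (hHD : exists_isReal_hodgeModel) (hU : BallQuotientUniformisedDatum) (h₃ : CMAbelianVarietyRealised)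
  (hA : Arapura2012_Cor_15_4_6)
variable {L : CMField} {ι₁ : L →+* ℂ} (V : HermSpace3 L ι₁)

/-- `ConjInto` (the Model's «`g` conjugates `Γ₁^{τ₁}` into `Γ₂^{τ₁}`») in the `Subgroup.map` currency of the Literature
lemmas. -/
private theorem map_conj_le_of_conjInto {X₁ X₂ : SchemeOver ℂ} {D₁ : UnitaryBallUniformisationDatum 2 X₁}
    {D₂ : UnitaryBallUniformisationDatum 2 X₂} {g : GL (Fin 3) ℂ} (h : ConjInto D₁ D₂ g) :
    (D₁.Γ.map (Matrix.GeneralLinearGroup.map D₁.τ₁)).map (MulAut.conj g).toMonoidHom ≤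
      D₂.Γ.map (Matrix.GeneralLinearGroup.map D₂.τ₁) := by
  rintro _ ⟨_, ⟨γ, hγ, rfl⟩, rfl⟩
  simpa [MulAut.conj_apply] using h γ hγ

/-- **The tower Kähler class system from the weight law.** In the anisotropic regime there is a family
`ω_Δ ∈ H²(X_Δ(ℂ); ℚ)`, `Δ : Level V`, of RATIONAL classes on the Picard modular surfaces of `V` such that (K) every
`ω_Δ ⊗ 1` is a Kähler class of `X_Δ`, (Ω2) `t_γ^* ω_{Δ₂} = ω_{Δ₁}` for every rational translate
`t_γ = transMor … γ Δ₁ Δ₂` (`γ ∈ U(V)(L₀)`, `γ Δ₁ γ⁻¹ ≤ Δ₂`) and (Ω1) `levelCover^* ω_Δ = ω_{Δ'}` for `Δ' ≤ Δ` — granted the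
weight law `BallFS.fsFormClass_weight_comm` for the Fubini–Study classes of projective systems of automorphic forms
(print: `ω_Δ ∈ ℚ_{>0} · c₁(K_{X_Δ})`, functorial under the étale maps of the tower).
[cite: GriffithsHarrisPrinciples1978, Ch. 1 §2] [cite: Shimura1971, §3.1 Prop. 3.1, §7.2–7.3]
[cite: VoisinHodgeI2002, §3.3.2 Lemma 3.16 and §7.1.2] [cite: HatcherAT2002, §3.G Prop. 3G.1] -/
theorem exists_towerKaehlerClassSystem (hFS : BallFS.fsFormClass_weight_comm) (h : IsAnisotropic L V.Hm) :
    ∃ ω : ∀ Δ : Level V, bettiCohomology (Var.scheme hU h₃ (.pms (pmsCode L ι₁ V Δ))) 2,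
      (∀ Δ : Level V, IsKaehlerClass 2 (Var.scheme hU h₃ (.pms (pmsCode L ι₁ V Δ)))
          (ofRatClass (ComplexPoints (Var.scheme hU h₃ (.pms (pmsCode L ι₁ V Δ)))) 2 (ω Δ))) ∧
      (∀ {γ : GL (Fin 3) L} (hγ : γ ∈ Urat V) {Δ₁ Δ₂ : Level V} (ht : TransCond γ Δ₁ Δ₂),
          BettiUniverse.pull (transMor hU h₃ hHD hA hγ Δ₁ Δ₂ ht) 2 (ω Δ₂) = ω Δ₁) ∧
      ∀ {Δ Δ' : Level V} (hle : Δ'.Γ ≤ Δ.Γ),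
          BettiUniverse.pull (levelCover hU h₃ hHD hA Δ Δ' hle) 2 (ω Δ) = ω Δ' := by
  classical
  by_cases hne : Nonempty (Level V)
  swap
  · exact ⟨fun Δ ↦ (hne ⟨Δ⟩).elim, fun Δ ↦ (hne ⟨Δ⟩).elim, fun _ Δ₁ ↦ (hne ⟨Δ₁⟩).elim, fun {Δ} ↦ (hne ⟨Δ⟩).elim⟩
  obtain ⟨Δ₀⟩ := hne
  -- the chosen ball data of the levels: one complex Gram matrix, one frame
  have han : ∀ Δ : Level V, (pmsCode L ι₁ V Δ).IsAnisotropic := fun Δ ↦ (isAnisotropic_pmsCode_iff L ι₁ V Δ).2 h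
  let D : ∀ Δ : Level V, UnitaryBallUniformisationDatum 2 (Var.scheme hU h₃ (.pms (pmsCode L ι₁ V Δ))) :=
    fun Δ ↦ Var.ballDatum hU h₃ (pmsCode L ι₁ V Δ) (han Δ)
  have hH : ∀ Δ Δ' : Level V, (D Δ').Hℂ = (D Δ).Hℂ := fun Δ Δ' ↦ ballDatum_Hℂ_eq hU h₃ Δ Δ' (han Δ') (han Δ)
  obtain ⟨𝔣₀⟩ := (D Δ₀).nonempty_sylvesterFrame
  let 𝔣 : ∀ Δ : Level V, (D Δ).SylvesterFrame :=
    fun Δ ↦ UnitaryBallUniformisationDatum.SylvesterFrame.transport (hH Δ₀ Δ) 𝔣₀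
  -- an immersive projective system at every level, and its Fubini–Study class
  have hsys := fun Δ : Level V ↦ BallProjective.exists_immersive_system ((D Δ).ballImage (𝔣 Δ))
  choose N k G hN hk hGh hG h0 himm using hsys
  have hcl : ∀ Δ : Level V, ∃ c : complexBetti (Var.scheme hU h₃ (.pms (pmsCode L ι₁ V Δ))) 2,
      ((D Δ).quotModel (𝔣 Δ)).pullback 2 c = ofRealClass ((D Δ).quotientSurface (𝔣 Δ)) 2
        (integrationDeRhamIsoFamily (Fin 2 → ℂ) ((D Δ).quotientSurface (𝔣 Δ)) 2
          (Literature.Geometry.Kaehler.deRhamCohomology.mk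
            ⟨BallFS.fsForm (G Δ) (hG Δ) (h0 Δ), BallFS.fsForm_mem_closedSmoothForms (hGh Δ) (hG Δ) (h0 Δ)⟩)) :=
    fun Δ ↦ ((D Δ).quotModel (𝔣 Δ)).pullback_surjective 2 _
  choose c hc using hcl
  -- (F) exact functoriality of `k⁻¹ · c` along morphisms over translations
  have hfun : ∀ {Δ₁ Δ₂ : Level V} {g : GL (Fin 3) ℂ} (hg : g ∈ (D Δ₂).realPoints) (hΓ : ConjInto (D Δ₁) (D Δ₂) g)
      (f : Var.scheme hU h₃ (.pms (pmsCode L ι₁ V Δ₁)) ⟶ Var.scheme hU h₃ (.pms (pmsCode L ι₁ V Δ₂)))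
      (hf : ∀ v ∈ (D Δ₁).cone, AlgPoints.map f ((D Δ₁).unif v) = (D Δ₂).unif ((g : Matrix (Fin 3) (Fin 3) ℂ) *ᵥ v)),
      (k Δ₁ : ℂ) • singularCohomology.map ℂ ℂ (AlgPoints.mapContinuous (L := ℂ) f) 2 (c Δ₂) = (k Δ₂ : ℂ) • c Δ₁ :=
    fun {Δ₁ Δ₂ g} hg hΓ f hf ↦
      (D Δ₂).smul_map_eq_smul_of_pullback_eq_fsForm (D Δ₁) (hH Δ₂ Δ₁) (𝔣 Δ₂) hFS hg (map_conj_le_of_conjInto hΓ) f hf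
        (hGh Δ₁) (hG Δ₁) (h0 Δ₁) (hk Δ₁) (hGh Δ₂) (hG Δ₂) (h0 Δ₂) (hk Δ₂) (hc Δ₁) (hc Δ₂)
  -- (F) for the level coverings and the rational translates
  have hfun_cover : ∀ {Δ Δ' : Level V} (hle : Δ'.Γ ≤ Δ.Γ),
      (k Δ' : ℂ) • singularCohomology.map ℂ ℂ (AlgPoints.mapContinuous (L := ℂ) (levelCover hU h₃ hHD hA Δ Δ' hle)) 2 (c Δ) =
        (k Δ : ℂ) • c Δ' :=
    fun {Δ Δ'} hle ↦ hfun (one_mem _) (conjInto_one_of_le (ballDatum_map_Γ_le hU h₃ hle (han Δ') (han Δ))) _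
      (fun v hv ↦ by rw [Units.val_one, Matrix.one_mulVec]; exact map_levelCover_unif hU h₃ hHD hA hle h hv)
  have hfun_trans : ∀ {γ : GL (Fin 3) L} (hγ : γ ∈ Urat V) {Δ₁ Δ₂ : Level V} (ht : TransCond γ Δ₁ Δ₂),
      (k Δ₁ : ℂ) • singularCohomology.map ℂ ℂ
          (AlgPoints.mapContinuous (L := ℂ) (transMor hU h₃ hHD hA hγ Δ₁ Δ₂ ht)) 2 (c Δ₂) = (k Δ₂ : ℂ) • c Δ₁ :=
    fun hγ Δ₁ Δ₂ ht ↦ hfun (map_ι₁_mem_realPoints hU h₃ hγ Δ₂ (han Δ₂)) (conjInto_of_transCond hU h₃ ht (han Δ₁) (han Δ₂)) _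
      (fun v hv ↦ map_transMor_unif hU h₃ hHD hA hγ ht h hv)
  -- the global scale from the reference level
  obtain ⟨K, r₀, hr₀, hK⟩ :=
    (D Δ₀).exists_kaehlerRationalDatum_fsForm (𝔣 Δ₀) (hGh Δ₀) (hG Δ₀) (h0 Δ₀) (himm Δ₀) (hN Δ₀)
  have hKc : ofRatClass _ 2 K.η = (r₀ : ℂ) • c Δ₀ :=
    ((D Δ₀).quotModel (𝔣 Δ₀)).pullback_injective 2 (by rw [map_smul, hc Δ₀, hK])
  have hk0 : ∀ Δ : Level V, (k Δ : ℂ) ≠ 0 := fun Δ ↦ Nat.cast_ne_zero.2 (hk Δ).ne'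
  -- the scale of level `Δ`: `s Δ := r₀ k_{Δ₀} / k_Δ`, so that `s Δ · c Δ = r · κ_Δ` with `r := r₀ k_{Δ₀}`
  obtain ⟨s, hs_pos, hs⟩ : ∃ s : Level V → ℝ, (∀ Δ, 0 < s Δ) ∧
      ∀ Δ, ((s Δ : ℝ) : ℂ) = (r₀ : ℂ) * (k Δ₀ : ℂ) * ((k Δ : ℂ))⁻¹ :=
    ⟨fun Δ ↦ r₀ * k Δ₀ / k Δ, fun Δ ↦ div_pos (mul_pos hr₀ (Nat.cast_pos.2 (hk Δ₀))) (Nat.cast_pos.2 (hk Δ)),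
      fun Δ ↦ by push_cast; ring⟩
  -- functoriality of `s · c`
  have hsfun : ∀ {Δ₁ Δ₂ : Level V} {F : Var.scheme hU h₃ (.pms (pmsCode L ι₁ V Δ₁)) ⟶ Var.scheme hU h₃ (.pms (pmsCode L ι₁ V Δ₂))},
      (k Δ₁ : ℂ) • singularCohomology.map ℂ ℂ (AlgPoints.mapContinuous (L := ℂ) F) 2 (c Δ₂) = (k Δ₂ : ℂ) • c Δ₁ →
        singularCohomology.map ℂ ℂ (AlgPoints.mapContinuous (L := ℂ) F) 2 (((s Δ₂ : ℝ) : ℂ) • c Δ₂) =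
          ((s Δ₁ : ℝ) : ℂ) • c Δ₁ := by
    intro Δ₁ Δ₂ F hF
    have hF' : singularCohomology.map ℂ ℂ (AlgPoints.mapContinuous (L := ℂ) F) 2 (c Δ₂) =
        ((k Δ₂ : ℂ) * ((k Δ₁ : ℂ))⁻¹) • c Δ₁ := by
      have := congrArg (fun x ↦ ((k Δ₁ : ℂ))⁻¹ • x) hF
      simp only [smul_smul, inv_mul_cancel₀ (hk0 Δ₁), one_smul] at this
      rw [this, mul_comm]
    rw [map_smul, hF', smul_smul, hs, hs]
    congr 1
    field_simp [hk0 Δ₁, hk0 Δ₂]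
  -- (R) rationality of `s Δ · c Δ` at every level, through the common level `Δ ⊓ Δ₀`
  have hrat : ∀ Δ : Level V, IsRationalClass (((s Δ : ℝ) : ℂ) • c Δ) := by
    intro Δ
    have hMΔ : (Δ ⊓ Δ₀).Γ ≤ Δ.Γ := Level.Γ_mono inf_le_left
    have hM₀ : (Δ ⊓ Δ₀).Γ ≤ Δ₀.Γ := Level.Γ_mono inf_le_right
    have ha := hsfun (hfun_cover hMΔ)
    have hb := hsfun (hfun_cover hM₀)
    have hs₀ : ((s Δ₀ : ℝ) : ℂ) • c Δ₀ = ofRatClass _ 2 K.η := by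
      rw [hKc, hs, mul_assoc, mul_inv_cancel₀ (hk0 Δ₀), mul_one]
    refine IsRationalClass.of_map_isFiniteCover (isFiniteCover_levelCover hU h₃ hHD hA Δ (Δ ⊓ Δ₀) hMΔ) ?_
    rw [ha, ← hb, hs₀]
    exact (isRationalClass_ofRatClass _).pullback _
  -- the rational classes
  have hω : ∀ Δ : Level V, ∃ a : bettiCohomology (Var.scheme hU h₃ (.pms (pmsCode L ι₁ V Δ))) 2,
      ofRatClass _ 2 a = ((s Δ : ℝ) : ℂ) • c Δ := fun Δ ↦ by
    obtain ⟨a, ha⟩ := (isRationalClass_iff_mem_range_ofRatClass _).1 (hrat Δ)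
    exact ⟨a, ha⟩
  choose ω hω using hω
  refine ⟨ω, fun Δ ↦ ?_, fun hγ Δ₁ Δ₂ ht ↦ ?_, fun {Δ Δ'} hle ↦ ?_⟩
  · -- (K) Kählerness
    rw [hω]
    exact (D Δ).isKaehlerClass_smul_of_pullback_eq_fsForm (𝔣 Δ) (hGh Δ) (hG Δ) (h0 Δ) (himm Δ) (hc Δ) (hs_pos Δ)
  · -- (Ω2) rational translates
    apply ofRatClass_injective 2
    have e := hω Δ₂
    rw [ofRatClass] at e
    rw [hω, ofRatClass, coeffClass_map, e]
    exact hsfun (hfun_trans hγ ht)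
  · -- (Ω1) level coverings
    apply ofRatClass_injective 2
    have e := hω Δ
    rw [ofRatClass] at e
    rw [hω, ofRatClass, coeffClass_map, e]
    exact hsfun (hfun_cover hle)

end Model.LevelTranslate

end HodgeCM

end
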